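import Summits.QuantumFields.YangMills.Theorems.BalabanUVNodesN15TwoSpacingGluingCurvedKnitCovariantLandauKnitClass335
import Summits.QuantumFields.YangMills.Theorems.BalabanUVNodesN15TwoSpacingGluingCurvedKnitCap
import HarnessLib

/-!
# N15 = NE2, road (c) — PROGRAMME (PC), (PC-F) «the per-cube KNIT», I: n15-c∕202 AND n15-c∕203 WITH AN EXTERNALLY CAPPED DECAY RATE — `cvP_cvGlued_spec_cap`, `cvP_cvGlued_spec_class335_cap`
# (dag-n15-c g30, n15-c∕316)

Cell `pub-ymgap`, seat `pub-ymgap-dag-n15-c` (generation g30; R134 (a), s1; HUMAN RULING D-0062).  `bears_on: R4∕N15 · K3⁸ SpineGivenEndpointR13SepCoPHV (stmt-QuantumFields-27366)`;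
filed `--kind proof --supports stmt-QuantumFields-27366 --as helper` — COUNT-NEUTRAL.  Two theorems, 0 `def`, 0 `sorry`; NO new estimate: the statements and proof texts of n15-c∕202
`…CurvedKnitCovariantLandauKnit.cvP_cvGlued_spec` and n15-c∕203 `…CurvedKnitCovariantLandauKnitClass335.cvP_cvGlued_spec_class335` VERBATIM, with the single change that the decay rate is
produced BELOW a caller's cap: `∀ δ_e > 0, ∃ δ ≤ δ_e, …` (the wrapper chain 202 → FILE 120 is re-run over n15-c∕208 `uN_cvGlued_spec_cap`, which is FILE 120 with `δ := min (min δ₀ δ₁) δ_e`).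
Imports BY NAME n15-c∕203 (for `cvChiNbhd`, `mem_cvChiNbhd_self`∕`_shift`∕`_shift_symm`, `cv_hP_live`, dag-n15-w2's `uN_localCoefLetters_of_gauge335`) and n15-c∕208.  Nothing in the tree is
modified ∕ restated (202∕203 stay the un-capped citizens).

WHY ((PC-F), HOME HANDOFF §g29 «RATE CAVEAT»).  n15-c∕202∕203 display the near∕far rows `hNVcut`∕`hfarN` of the perturbation `(N_V^Q + N_V^R)(U^{u₀ k})` AT THE KNIT's OWN existential rate
`δ`.  The per-cube Landau letter n15-c∕314∕315 (`hasMaj_cvNVr_cvGauge_cut`) delivers the `N_V^R` row at ITS existential rate `δ_R`; `HasMaj` rows only weaken in the rate, so they can be fed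
in only if the knit's rate is `≤ δ_R`.  THIS FILE makes 202∕203 cappable (`δ_e := δ_R` in the assembly n15-c∕319); the constants `w₀, R₀, θ₀, B` then depend on `δ_e`.

HONEST FRAMING ∕ LIMITS.  As n15-c∕202∕203 (MODEL: doubled-torus cover, one averaging level, uniform weights, one-level staircases, `Q(U)` = main term (125) of [B7] (124), component-blind site
gauges; the `N_V` rows stay displayed HERE — they are produced in n15-c∕318∕319).  NOT [Balaban1985BackgroundPropagators] Thm 3.1∕3.3 as printed; NE2⁺ NOT PRINTED; N15 of record untouched
(DISCHARGED AS CONSUMED, p687738); K3⁸ OPEN; counts UNMOVED (typed 28∕28); one finite 𝕋⁴ at fixed ε per index — NOT infinite volume ∕ OS ∕ mass gap ∕ Clay.  Restate-immune (no Theses import).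
-/

noncomputable section

open scoped BigOperators Matrix Matrix.Norms.Frobenius

namespace Summit.QuantumFields.YangMills.BalabanUVNodes.N15.Gluing

open Real
open Literature.MathematicalPhysics.QuantumFieldTheory.Balaban1983to89
open Literature.MathematicalPhysics.QuantumFieldTheory.Balaban1983to89.B5Prop11Plancherel (Tor fine unitVec)
open Literature.MathematicalPhysics.QuantumFieldTheory.Balaban1983to89.B11SectG (BlockNorm HasMaj)
open Literature.MathematicalPhysics.QuantumFieldTheory.Balaban1983to89.B6Prop26Gluing (mulOp mulOp_apply)
open Literature.MathematicalPhysics.QuantumFieldTheory.Balaban1983to89.B6UnitTorusCarrier (unitTorusGeo)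
open Literature.MathematicalPhysics.QuantumFieldTheory.Balaban1983to89.B9Eq39Adjoint (covD fluct)
open Literature.MathematicalPhysics.QuantumFieldTheory.Balaban1983to89.B9Eq3117Current (gaugeTr)
open Literature.Barriers.QuantumFields (traceForm)
open Summit.QuantumFields.YangMills.BalabanUVNodes.N15.BackgroundLayer (covLapM tCoefA tCoefC)
open Summit.QuantumFields.YangMills.BalabanUVNodes.N15.VectorPiece (bshiftEquiv bshiftEquiv_apply bshiftEquiv_symm_apply)
open Summit.QuantumFields.YangMills.BalabanUVNodes.N15.MatrixSpecies (mmulOp coordMat basisConst)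
open Summit.QuantumFields.YangMills.BalabanUVNodes.N15.CurvedSpecies (gaugePair uN_localCoefLetters_of_gauge335 uN_val_inv_eq_conjTranspose)

variable {d : ℕ} {L : ℕ} [NeZero L]

/-! ## §1 n15-c∕202 capped -/

section Knit202

/-- ★★★ (RATE-CAPPED EDITION of n15-c∕202 `cvP_cvGlued_spec`: `∀ δ_e > 0, ∃ δ ≤ δ_e`; otherwise verbatim, over n15-c∕208 `uN_cvGlued_spec_cap`) **FILE 120 FOR BAŁABAN's FULLY COVARIANT SUMMAND IN PER-CUBE GAUGES** (`uN_cvGlued_spec` with `u k := u₀ k ∘ pr₁`, `P := N_L ⊗ 1 − N_V^Q(U) − N_V^R(U) = a·Q*(U)Q(U) −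
D_U(I−R(U))D*_U`, `N_V k := (N_V^Q + N_V^R)(U^{u₀ k})`, the conjugation row `hP` DISCHARGED by n15-c∕201 `cv_hP_live`): for odd `L ≥ 7`, `a > 0`, a colour index `ι` there are
`δ, w₀, R₀, θ₀, B > 0` such that on every doubled torus of the cover (`k ≥ 1`, `L^m ≥ w₀`), for trace-form coordinates `e`, unitary site gauges `u₀ k`, EVERY bond field `U` and letters
`r_V, R_N, θ_F ≥ 0` with `r_V(1 + |J ⊕ J|) + R_N ≤ R₀`, `θ_F ≤ θ₀`: IF the species letters of `Δ_{R_{U^{u₀ k}}}` on the cut boxes are `≤ r_V` and the perturbation `(N_V^Q + N_V^R)(U^{u₀ k})`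
is `≤ R_N e^{−δd}` between the plateau and the cut box and `≤ θ_F e^{−δd}` off the plateau, THEN the glued operator of the dressed smooth-cut cubes in the gauges `u₀ k` is
`≤ B·e^{−(δ∕16)d}` blockwise AND the two-sided inverse of `Δ_{R_U} + a·Q*(U)Q(U) − D_U(I−R(U))D*_U`.  MODEL; NOT [B9] Thm 3.1∕3.3 as printed.
[cite: Balaban1985BackgroundPropagators, Thm 3.1 p.397 and Thm 3.3 p.399 (shape: «G(U) … for U satisfying (3.35)»), (3.26) p.395, (3.31)–(3.35) pp.395–396, (3.49) p.399, (3.50)–(3.54) pp.400–401, (3.59)–(3.65) pp.402–403, (3.76)–(3.77) p.406; Balaban1984PropagatorsII, (2.91)–(2.93) p.239] -/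
theorem cvP_cvGlued_spec_cap (hL : Odd L ∧ 1 < L) (hL7 : 7 ≤ L) {a : ℝ} (ha : 0 < a) (ι : Type) [Fintype ι] [DecidableEq ι] {δe : ℝ} (hδe : 0 < δe) :
    ∃ δ w₀ R₀ θ₀ B : ℝ, 0 < δ ∧ δ ≤ δe ∧ 0 < R₀ ∧ 0 < θ₀ ∧ 0 < B ∧
      ∀ (mv kk : ℕ), 1 ≤ kk → w₀ ≤ ((L ^ mv : ℕ) : ℝ) →
      ∀ {mm : Type} [Fintype mm] [DecidableEq mm] (e : Matrix mm mm ℂ ≃L[ℝ] (ι → ℝ)), (∀ A B : Matrix mm mm ℂ, traceForm A B = e A ⬝ᵥ e B) →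
      ∀ (u₀ : (Fin (d + 1) → ZMod (2 * L)) → Tor (fine (L ^ kk) (cvM d L mv kk hL)) → Matrix mm mm ℂ), (∀ k x, (u₀ k x)ᴴ * u₀ k x = 1) →
      ∀ (U : Fin (d + 1) → CvX d L mv kk hL → Matrix mm mm ℂ) (rV RN θF : ℝ),
        0 ≤ rV → 0 ≤ RN → 0 ≤ θF → rV * (1 + Fintype.card (Fin (d + 1) ⊕ Fin (d + 1))) + RN ≤ R₀ → θF ≤ θ₀ →
        (∀ k x, cvChi d L mv kk hL k x ≠ 0 → ∀ i, ∑ j, |tCoefC ((((L ^ kk : ℕ) : ℝ))⁻¹) (gaugePair (bshiftEquiv (cvM d L mv kk hL) (L ^ kk)) fun μ x => coordMat e (ContinuousLinearMap.mulLeftRight ℝ (Matrix mm mm ℂ) (u₀ k x.1 * U μ x * (u₀ k (bshiftEquiv (cvM d L mv kk hL) (L ^ kk) μ x).1)ᴴ) (u₀ k x.1 * U μ x * (u₀ k (bshiftEquiv (cvM d L mv kk hL) (L ^ kk) μ x).1)ᴴ)ᴴ)) x i j| ≤ rV) →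
        (∀ k j' x, cvChi d L mv kk hL k x ≠ 0 → ∀ i, ∑ j, |tCoefA ((((L ^ kk : ℕ) : ℝ))⁻¹) (gaugePair (bshiftEquiv (cvM d L mv kk hL) (L ^ kk)) fun μ x => coordMat e (ContinuousLinearMap.mulLeftRight ℝ (Matrix mm mm ℂ) (u₀ k x.1 * U μ x * (u₀ k (bshiftEquiv (cvM d L mv kk hL) (L ^ kk) μ x).1)ᴴ) (u₀ k x.1 * U μ x * (u₀ k (bshiftEquiv (cvM d L mv kk hL) (L ^ kk) μ x).1)ᴴ)ᴴ)) j' x i j| ≤ rV) →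
        (∀ k, HasMaj (CvNorm d L mv kk hL ι) (CvNorm d L mv kk hL ι) (mulOp (fun p : CvX d L mv kk hL × ι => cvPsi d L mv kk hL k p.1) ∘ₗ (cvNVq d L mv kk hL a ι e (cvGauge d L mv kk hL (fun p => u₀ k p.1) U) + cvNVr d L mv kk hL a ι e (cvGauge d L mv kk hL (fun p => u₀ k p.1) U)) ∘ₗ mulOp (fun p : CvX d L mv kk hL × ι => cvChi d L mv kk hL k p.1)) (fun y y' => RN * Real.exp (-(δ * (unitTorusGeo L kk (cvM d L mv kk hL)).dist y y')))) →
        (∀ k, HasMaj (CvNorm d L mv kk hL ι) (CvNorm d L mv kk hL ι) ((LinearMap.id - mulOp (fun p : CvX d L mv kk hL × ι => cvPsi d L mv kk hL k p.1)) ∘ₗ (cvNVq d L mv kk hL a ι e (cvGauge d L mv kk hL (fun p => u₀ k p.1) U) + cvNVr d L mv kk hL a ι e (cvGauge d L mv kk hL (fun p => u₀ k p.1) U)) ∘ₗ mulOp (fun p : CvX d L mv kk hL × ι => cvChi d L mv kk hL k p.1)) (fun y y' => θF * Real.exp (-(δ * (unitTorusGeo L kk (cvM d L mv kk hL)).dist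 y y')))) →
        HasMaj (CvNorm d L mv kk hL ι) (CvNorm d L mv kk hL ι) (cvGlued d L mv kk hL a ((((L ^ kk : ℕ) : ℝ))⁻¹) ι e (fun k (p : CvX d L mv kk hL) => u₀ k p.1) U (cvNL d L mv kk hL a ι - cvNVq d L mv kk hL a ι e U - cvNVr d L mv kk hL a ι e U) (fun k => (cvNVq d L mv kk hL a ι e (cvGauge d L mv kk hL (fun p => u₀ k p.1) U) + cvNVr d L mv kk hL a ι e (cvGauge d L mv kk hL (fun p => u₀ k p.1) U))))
          (fun y y' => B * Real.exp (-(δ / 16 * (unitTorusGeo L kk (cvM d L mv kk hL)).dist y y'))) ∧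
        (cvGlued d L mv kk hL a ((((L ^ kk : ℕ) : ℝ))⁻¹) ι e (fun k (p : CvX d L mv kk hL) => u₀ k p.1) U (cvNL d L mv kk hL a ι - cvNVq d L mv kk hL a ι e U - cvNVr d L mv kk hL a ι e U) (fun k => (cvNVq d L mv kk hL a ι e (cvGauge d L mv kk hL (fun p => u₀ k p.1) U) + cvNVr d L mv kk hL a ι e (cvGauge d L mv kk hL (fun p => u₀ k p.1) U))) ∘ₗ (covLapM (bshiftEquiv (cvM d L mv kk hL) (L ^ kk)) ((((L ^ kk : ℕ) : ℝ))⁻¹) (gaugePair (bshiftEquiv (cvM d L mv kk hL) (L ^ kk)) (fun μ x => coordMat e (ContinuousLinearMap.mulLeftRight ℝ (Matrix mm mm ℂ) (U μ x) (U μ x)ᴴ))) + (cvNL d L mv kk hL a ι - cvNVq d L mv kk hL a ι e U - cvNVr d L mv kk hL a ι e U)) = LinearMap.id ∧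
          (covLapM (bshiftEquiv (cvM d L mv kk hL) (L ^ kk)) ((((L ^ kk : ℕ) : ℝ))⁻¹) (gaugePair (bshiftEquiv (cvM d L mv kk hL) (L ^ kk)) (fun μ x => coordMat e (ContinuousLinearMap.mulLeftRight ℝ (Matrix mm mm ℂ) (U μ x) (U μ x)ᴴ))) + (cvNL d L mv kk hL a ι - cvNVq d L mv kk hL a ι e U - cvNVr d L mv kk hL a ι e U)) ∘ₗ cvGlued d L mv kk hL a ((((L ^ kk : ℕ) : ℝ))⁻¹) ι e (fun k (p : CvX d L mv kk hL) => u₀ k p.1) U (cvNL d L mv kk hL a ι - cvNVq d L mv kk hL a ι e U - cvNVr d L mv kk hL a ι e U) (fun k => (cvNVq d L mv kk hL a ι e (cvGauge d L mv kk hL (fun p => u₀ k p.1) U) + cvNVr d L mv kk hL a ι e (cvGauge d L mv kk hL (fun p => u₀ k p.1) U))) = LinearMap.id)  := by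
  obtain ⟨δ, w₀, R₀, θ₀, B, hδ, hδe', hR₀, hθ₀, hB, H⟩ := uN_cvGlued_spec_cap (d := d) hL hL7 ha ι hδe
  refine ⟨δ, w₀, R₀, θ₀, B, hδ, hδe', hR₀, hθ₀, hB, fun mv kk hk hw₀ => ?_⟩
  intro mm _ _ e he u₀ hu U rV RN θF hrV hRN hθF hRle hθle hC hA hNVcut hfarN
  exact H mv kk hk hw₀ e he (fun k (p : CvX d L mv kk hL) => u₀ k p.1) (fun k p => hu k p.1) U
    (cvNL d L mv kk hL a ι - cvNVq d L mv kk hL a ι e U - cvNVr d L mv kk hL a ι e U)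
    (fun k => cvNVq d L mv kk hL a ι e (cvGauge d L mv kk hL (fun p => u₀ k p.1) U) + cvNVr d L mv kk hL a ι e (cvGauge d L mv kk hL (fun p => u₀ k p.1) U))
    rV RN θF hrV hRN hθF hRle hθle (fun k => cv_hP_live mv kk hL a e he hu U k) hC hA hNVcut hfarN


end Knit202

/-! ## §2 n15-c∕203 capped -/

section Knit

open scoped Matrix.Norms.L2Operator

/-- ★★★ (RATE-CAPPED EDITION of n15-c∕203 `cvP_cvGlued_spec_class335`: `∀ δ_e > 0, ∃ δ ≤ δ_e`; otherwise verbatim) **n15-c∕202 ON THE REGULARITY CLASS (3.35): FILE 120 FOR BAŁABAN's FULLY COVARIANT SUMMAND IN PER-CUBE SITE GAUGES, THE SPECIES ROWS PRODUCED FROM THE PER-CUBE GAUGE DATA**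
(`U^{u₀ k} = e^{iηA_k}`, `‖A_k‖ < C∕ξ`, `‖η⁻¹∇^ηA_k‖ < C∕ξ²` on the neighbourhood of the cut box; dag-n15-w2's `uN_localCoefLetters_of_gauge335` with the lifted gauge as its own unitary
extension); displayed: the near∕far letters of `(N_V^Q + N_V^R)(U^{u₀ k})`.  MODEL; NOT [B9] Thm 3.1∕3.3 as printed.
[cite: Balaban1985BackgroundPropagators, (3.35) p.396, Thm 3.1 p.397 and Thm 3.3 p.399 (shape), (3.26) p.395, (3.31)–(3.34) pp.395–396, (3.50)–(3.54) pp.400–401, (3.59)–(3.65) pp.402–403; Balaban1984PropagatorsII, (2.91)–(2.93) p.239] -/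
theorem cvP_cvGlued_spec_class335_cap (hL : Odd L ∧ 1 < L) (hL7 : 7 ≤ L) {a : ℝ} (ha : 0 < a) (ι : Type) [Fintype ι] [DecidableEq ι] {δe : ℝ} (hδe : 0 < δe) :
    ∃ δ w₀ R₀ θ₀ B : ℝ, 0 < δ ∧ δ ≤ δe ∧ 0 < R₀ ∧ 0 < θ₀ ∧ 0 < B ∧
      ∀ (mv kk : ℕ), 1 ≤ kk → w₀ ≤ ((L ^ mv : ℕ) : ℝ) →
      ∀ {mm : Type} [Fintype mm] [DecidableEq mm] [Nonempty mm] (e : Matrix mm mm ℂ ≃L[ℝ] (ι → ℝ)), (∀ A B : Matrix mm mm ℂ, traceForm A B = e A ⬝ᵥ e B) →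
      ∀ (u₀ : (Fin (d + 1) → ZMod (2 * L)) → Tor (fine (L ^ kk) (cvM d L mv kk hL)) → (Matrix mm mm ℂ)ˣ), (∀ k x, (u₀ k x : Matrix mm mm ℂ) ∈ Matrix.unitaryGroup mm ℂ) →
      ∀ (Uu : Fin (d + 1) → CvX d L mv kk hL → (Matrix mm mm ℂ)ˣ), (∀ μ x, (Uu μ x : Matrix mm mm ℂ) ∈ Matrix.unitaryGroup mm ℂ) →
      ∀ (Acl : (Fin (d + 1) → ZMod (2 * L)) → Fin (d + 1) → CvX d L mv kk hL → Matrix mm mm ℂ) (ξ C : ℝ), 0 < ξ → 0 ≤ C →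
        (∀ k μ z, z ∈ cvChiNbhd d L mv kk hL k → gaugeTr (bshiftEquiv (cvM d L mv kk hL) (L ^ kk)) (fun z : CvX d L mv kk hL => u₀ k z.1) Uu μ z = fluct ((((L ^ kk : ℕ) : ℝ))⁻¹) (Acl k) μ z) →
        (∀ k μ z, z ∈ cvChiNbhd d L mv kk hL k → ‖Acl k μ z‖ < C * ξ⁻¹) →
        (∀ k μ ν z, z ∈ cvChiNbhd d L mv kk hL k → ‖(((((((L ^ kk : ℕ) : ℝ))⁻¹) : ℝ) : ℂ)⁻¹) • covD (bshiftEquiv (cvM d L mv kk hL) (L ^ kk)) (fun _ _ => (1 : (Matrix mm mm ℂ)ˣ)) μ (Acl k ν) z‖ < C * (ξ ^ 2)⁻¹) →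
      ∀ (rV RN θF : ℝ),
        0 ≤ rV → 0 ≤ RN → 0 ≤ θF → rV * (1 + Fintype.card (Fin (d + 1) ⊕ Fin (d + 1))) + RN ≤ R₀ → θF ≤ θ₀ →
        Fintype.card ι * (@basisConst ι _ (Matrix mm mm ℂ) Matrix.frobeniusNormedAddCommGroup Matrix.frobeniusNormedSpace e * (2 * Real.sqrt (Fintype.card mm)) * (Real.sqrt (Fintype.card mm) * ((C / ξ) * Real.exp (((((L ^ kk : ℕ) : ℝ))⁻¹) * (C / ξ))))) ≤ rV →
        Fintype.card ι * (Fintype.card (Fin (d + 1)) * (Fintype.card ι * (@basisConst ι _ (Matrix mm mm ℂ) Matrix.frobeniusNormedAddCommGroup Matrix.frobeniusNormedSpace e * (2 * Real.sqrt (Fintype.card mm)) * (Real.sqrt (Fintype.card mm) * ((C / ξ) * Real.exp (((((L ^ kk : ℕ) : ℝ))⁻¹) * (C / ξ))))) ^ 2 + @basisConst ι _ (Matrix mm mm ℂ) Matrix.frobeniusNormedAddCommGroup Matrix.frobeniusNormedSpace e * (2 * Real.sqrt (Fintype.card mm)) * (Real.sqrt (Fintype.card mm) * ((C / ξ ^ 2)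 * Real.exp (((((L ^ kk : ℕ) : ℝ))⁻¹) * (C / ξ)))))) ≤ rV →
        (∀ k, HasMaj (CvNorm d L mv kk hL ι) (CvNorm d L mv kk hL ι) (mulOp (fun p : CvX d L mv kk hL × ι => cvPsi d L mv kk hL k p.1) ∘ₗ (cvNVq d L mv kk hL a ι e (cvGauge d L mv kk hL (fun p => (u₀ k p.1 : Matrix mm mm ℂ)) (fun μ x => (Uu μ x : Matrix mm mm ℂ))) + cvNVr d L mv kk hL a ι e (cvGauge d L mv kk hL (fun p => (u₀ k p.1 : Matrix mm mm ℂ)) (fun μ x => (Uu μ x : Matrix mm mm ℂ)))) ∘ₗ mulOp (fun p : CvX d L mv kk hL × ι => cvChi d L mv kk hL k p.1)) (fun y y' => RN * Real.exp (-(δ * (unitTorusGeo L kk (cvM d L mv kk hL)).dist y y')))) →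
        (∀ k, HasMaj (CvNorm d L mv kk hL ι) (CvNorm d L mv kk hL ι) ((LinearMap.id - mulOp (fun p : CvX d L mv kk hL × ι => cvPsi d L mv kk hL k p.1)) ∘ₗ (cvNVq d L mv kk hL a ι e (cvGauge d L mv kk hL (fun p => (u₀ k p.1 : Matrix mm mm ℂ)) (fun μ x => (Uu μ x : Matrix mm mm ℂ))) + cvNVr d L mv kk hL a ι e (cvGauge d L mv kk hL (fun p => (u₀ k p.1 : Matrix mm mm ℂ)) (fun μ x => (Uu μ x : Matrix mm mm ℂ)))) ∘ₗ mulOp (fun p : CvX d L mv kk hL × ι => cvChi d L mv kk hL k p.1)) (fun y y' => θF * Real.exp (-(δ * (unitTorusGeo L kk (cvM d L mv kk hL)).dist y y')))) →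
        HasMaj (CvNorm d L mv kk hL ι) (CvNorm d L mv kk hL ι) (cvGlued d L mv kk hL a ((((L ^ kk : ℕ) : ℝ))⁻¹) ι e (fun k (p : CvX d L mv kk hL) => (u₀ k p.1 : Matrix mm mm ℂ)) (fun μ x => (Uu μ x : Matrix mm mm ℂ)) (cvNL d L mv kk hL a ι - cvNVq d L mv kk hL a ι e (fun μ x => (Uu μ x : Matrix mm mm ℂ)) - cvNVr d L mv kk hL a ι e (fun μ x => (Uu μ x : Matrix mm mm ℂ))) (fun k => (cvNVq d L mv kk hL a ι e (cvGauge d L mv kk hL (fun p => (u₀ k p.1 : Matrix mm mm ℂ)) (fun μ x => (Uu μ x : Matrix mm mm ℂ))) + cvNVr d L mv kk hL a ι e (cvGauge d L mv kk hL (fun p => (u₀ k p.1 : Matrix mm mm ℂ)) (fun μ x => (Uu μ x : Matrix mm mm ℂ))))))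
          (fun y y' => B * Real.exp (-(δ / 16 * (unitTorusGeo L kk (cvM d L mv kk hL)).dist y y'))) ∧
        (cvGlued d L mv kk hL a ((((L ^ kk : ℕ) : ℝ))⁻¹) ι e (fun k (p : CvX d L mv kk hL) => (u₀ k p.1 : Matrix mm mm ℂ)) (fun μ x => (Uu μ x : Matrix mm mm ℂ)) (cvNL d L mv kk hL a ι - cvNVq d L mv kk hL a ι e (fun μ x => (Uu μ x : Matrix mm mm ℂ)) - cvNVr d L mv kk hL a ι e (fun μ x => (Uu μ x : Matrix mm mm ℂ))) (fun k => (cvNVq d L mv kk hL a ι e (cvGauge d L mv kk hL (fun p => (u₀ k p.1 : Matrix mm mm ℂ)) (fun μ x => (Uu μ x : Matrix mm mm ℂ))) + cvNVr d L mv kk hL a ι e (cvGauge d L mv kk hL (fun p => (u₀ k p.1 : Matrix mm mm ℂ)) (fun μ x => (Uu μ x : Matrix mm mm ℂ))))) ∘ₗ (covLapM (bshiftEquiv (cvM d L mv kk hL) (L ^ kk)) ((((L ^ kk : ℕ) : ℝ))⁻¹) (gaugePair (bshiftEquiv (cvM d L mv kk hL) (L ^ kk)) (fun μ x => coordMat e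 (ContinuousLinearMap.mulLeftRight ℝ (Matrix mm mm ℂ) ((Uu μ x : Matrix mm mm ℂ)) ((Uu μ x : Matrix mm mm ℂ))ᴴ))) + (cvNL d L mv kk hL a ι - cvNVq d L mv kk hL a ι e (fun μ x => (Uu μ x : Matrix mm mm ℂ)) - cvNVr d L mv kk hL a ι e (fun μ x => (Uu μ x : Matrix mm mm ℂ)))) = LinearMap.id ∧
          (covLapM (bshiftEquiv (cvM d L mv kk hL) (L ^ kk)) ((((L ^ kk : ℕ) : ℝ))⁻¹) (gaugePair (bshiftEquiv (cvM d L mv kk hL) (L ^ kk)) (fun μ x => coordMat e (ContinuousLinearMap.mulLeftRight ℝ (Matrix mm mm ℂ) ((Uu μ x : Matrix mm mm ℂ)) ((Uu μ x : Matrix mm mm ℂ))ᴴ))) + (cvNL d L mv kk hL a ι - cvNVq d L mv kk hL a ι e (fun μ x => (Uu μ x : Matrix mm mm ℂ)) - cvNVr d L mv kk hL a ι e (fun μ x => (Uu μ x : Matrix mm mm ℂ)))) ∘ₗ cvGlued d L mv kk hL a ((((L ^ kk : ℕ) : ℝ))⁻¹) ι e (fun k (p : CvX d L mv kk hL) =>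 (u₀ k p.1 : Matrix mm mm ℂ)) (fun μ x => (Uu μ x : Matrix mm mm ℂ)) (cvNL d L mv kk hL a ι - cvNVq d L mv kk hL a ι e (fun μ x => (Uu μ x : Matrix mm mm ℂ)) - cvNVr d L mv kk hL a ι e (fun μ x => (Uu μ x : Matrix mm mm ℂ))) (fun k => (cvNVq d L mv kk hL a ι e (cvGauge d L mv kk hL (fun p => (u₀ k p.1 : Matrix mm mm ℂ)) (fun μ x => (Uu μ x : Matrix mm mm ℂ))) + cvNVr d L mv kk hL a ι e (cvGauge d L mv kk hL (fun p => (u₀ k p.1 : Matrix mm mm ℂ)) (fun μ x => (Uu μ x : Matrix mm mm ℂ))))) = LinearMap.id)  := by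
  obtain ⟨δ, w₀, R₀, θ₀, B, hδ, hδe', hR₀, hθ₀, hB, H⟩ := cvP_cvGlued_spec_cap (d := d) hL hL7 ha ι hδe
  refine ⟨δ, w₀, R₀, θ₀, B, hδ, hδe', hR₀, hθ₀, hB, fun mv kk hk hw₀ => ?_⟩
  intro mm _ _ _ e he u₀ hu₀ Uu hUu Acl ξ C hξ hC hg hAcl hDcl rV RN θF hrV hRN hθF hRle hθle hrA hrC hNVcut hfarN
  have hη : (0 : ℝ) < ((((L ^ kk : ℕ) : ℝ))⁻¹) := inv_pos.mpr (Nat.cast_pos.mpr (pow_pos (Nat.pos_of_ne_zero (NeZero.ne L)) kk))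
  -- the lifted site gauges are unitary everywhere, hence of unitary type (operator norm) and orthogonal in coordinates
  have hw : ∀ k (y : CvX d L mv kk hL), ((u₀ k y.1 : Matrix mm mm ℂ))ᴴ * (u₀ k y.1 : Matrix mm mm ℂ) = 1 := fun k y => Matrix.mem_unitaryGroup_iff'.mp (hu₀ k y.1)
  have hu1 : ∀ k (z : CvX d L mv kk hL), ‖((u₀ k z.1 : (Matrix mm mm ℂ)ˣ) : Matrix mm mm ℂ)‖ ≤ 1 ∧ ‖((((u₀ k z.1)⁻¹ : (Matrix mm mm ℂ)ˣ)) : Matrix mm mm ℂ)‖ ≤ 1 := fun k z =>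
    ⟨(CStarRing.norm_of_mem_unitary (hu₀ k z.1)).le, by
      rw [uN_val_inv_eq_conjTranspose (hu₀ k z.1)]
      exact (CStarRing.norm_of_mem_unitary (Unitary.star_mem (hu₀ k z.1))).le⟩
  have hlet : ∀ k (x : CvX d L mv kk hL), cvChi d L mv kk hL k x ≠ 0 → _ := fun k x hx =>
    uN_localCoefLetters_of_gauge335 e (bshiftEquiv (cvM d L mv kk hL) (L ^ kk)) Uu he hη hUu (Q := cvChiNbhd d L mv kk hL k) hξ hC
      (u := fun z : CvX d L mv kk hL => u₀ k z.1) (A := Acl k) (fun z _ => hu1 k z) (hg k) (hAcl k) (hDcl k)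
      (w := fun z : CvX d L mv kk hL => (u₀ k z.1 : Matrix mm mm ℂ)) (hw k) (fun z _ => rfl) (mem_cvChiNbhd_self hx) (mem_cvChiNbhd_shift hx) (mem_cvChiNbhd_shift_symm hx)
  exact H mv kk hk hw₀ e he (fun k x => (u₀ k x : Matrix mm mm ℂ)) (fun k x => Matrix.mem_unitaryGroup_iff'.mp (hu₀ k x)) (fun μ x => (Uu μ x : Matrix mm mm ℂ)) rV RN θF
    hrV hRN hθF hRle hθle (fun k x hx i => ((hlet k x hx).2 i).trans hrC) (fun k j' x hx i => ((hlet k x hx).1 j' i).trans hrA) hNVcut hfarN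

end Knit

end Summit.QuantumFields.YangMills.BalabanUVNodes.N15.Gluing

end
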